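import Literature.AlgebraicGeometry.Deformation.AdaptedObstructionTrace
import Literature.AlgebraicGeometry.HodgeTheory.AtiyahClassCech
import Literature.AlgebraicGeometry.Modules.CechCup
import Literature.AlgebraicGeometry.Modules.CechEndCochainFamily
import Literature.AlgebraicGeometry.Modules.CechSheafHomExchange
import HarnessLib

/-!
# `σ₀` and `σ₁` of the obstruction cocycle at cochain level: additivity along adapted short exact sequences

Setting of `Deformation/AdaptedLifts.lean` / `Deformation/AdaptedObstructionTrace.lean`: `j : Y ⟶ Z₀`,
`i : Z₀ ⟶ Z₁`, `eI : i_* j_* 𝒪_Y ≅ 𝓘`, a short exact sequence `0 → F₁ → F₂ → F₃ → 0` of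
`𝒪_{Z₀}`-modules with an ADAPTED frame cover `A` (frames of `F₂` made of frames of `F₁` and lifted
frames of `F₃`) and ADAPTED lifts `T̃² = [[T̃¹, X],[0, T̃³]]`; the three defect cochains `κ(c^m)` live in
the base framings of `E_m = j^* F_m` on the common cover `(j⁻¹i⁻¹U_a)_a` of `Y`, with families of local
endomorphisms `ω_m = toLocalFamily κ(c^m)` (`Modules/CechEndCochainFamily.lean`).

* `pairing δ P Q = Σ_{m,i} P_{mi} · δ(Q_{im})` and its splitting for block upper triangular matrices
  with rectangular blocks (`pairing_fromBlocks`, `pairing_fromBlocks_mul`);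
* `appLE_toLocalFamily` — the value of a component of `toLocalFamily c` over `W ≤ U_γ` is the local
  operator of the matrix over `W`;
* `contract_cupFamily_atiyahCocycle` — **the frame formula for the `Ω¹`-contraction of the cup product
  `ω ∪ At`** (`Modules/CechCup.lean`, `HodgeTheory/AtiyahClassCech.lean`) of the family of a matrix
  `2`-cochain `κ` with the Atiyah cocycle, on a `3`-simplex `β = (a, b, d, e)`:
  `c_{Ω¹}((ω ∪ At)_β) = ⟪T_{ad}, T_{da}N⟫_d - ⟪T_{ae}, T_{ea}N⟫_d`, `N = κ_{abd} T_{da}`;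
* `contract_cupFamily_atiyahCocycle_adapted`, `pushFamily_contract_cupFamily_adapted` — **for adapted
  data these contractions are additive**, `c₂ = c₁ + c₃`, hence so are the pushed-forward cochains
  `c_{Ω¹,*}(ω_m ∪ At_m)` (`Cech.pushFamily`, `Modules/CechSheafHomExchange.lean`): all matrices are block
  upper triangular (`T_baseFraming_cover₂`, `kdefAt_adapted`);
(the trace analogue `tr ω₂(β) = tr ω₁(β) + tr ω₃(β)` is `trace_toLocalFamily_defectCochain_adapted`,
`Deformation/AdaptedObstructionTraceClass.lean`).

Combined with `Tr(θ(ω)) = θ(tr_* ω)` (`Modules/CechThetaTrace.lean`), `[ω] ∘ At = [ω ∪ At]`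
(`Cech.classOf_cupFamily`) and `At(E) = [At-cocycle]` (`atiyahClass_eq_classOf`), these are the
cochain identities behind the additivity of `σ₀ = tr(ob)` and `σ₁ = tr(At · ob)` along short exact
sequences, Buchweitz–Flenner 2003, Prop. 4.2 (there via `σ_k(ob) = ⟨[Z₁], ch_{k+1}⟩` and the
additivity of the Chern character). Everything is proved; no named facts.

## References

* R.-O. Buchweitz, H. Flenner, *A semiregularity map for modules and applications to deformations*,
  Compositio Math. 137 (2003), Prop. 4.2, Prop. 4.4. [BuchweitzFlenner2003]
* R. Hartshorne, *Deformation Theory*, GTM 257 (2010), §7, proof of Thm. 7.1. [Hartshorne2010]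
-/

noncomputable section

universe u

open CategoryTheory AlgebraicGeometry Opposite TopologicalSpace

namespace Literature.AlgebraicGeometry.Deformation

open Matrix

section Pairing

variable {R M : Type*} [Semiring R] [AddCommMonoid M] [Module R M]

/-- **The `δ`-pairing of two matrices**: `⟪P, Q⟫_δ = Σ_{m,i} P_{mi} · δ(Q_{im})` (in the application:
`P` a transition matrix, `Q` a matrix of functions, `δ` the universal derivation; the frame value of
the contraction `tr(P · dQ)`). [cite: BuchweitzFlenner2003, Prop. 4.2] -/
def pairing {n o : Type*} [Fintype n] [Fintype o] (δ : R →+ M) (P : Matrix n o R) (Q : Matrix o n R) : M :=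
  ∑ m, ∑ i, P m i • δ (Q i m)

/-- Unfolding the pairing. [folklore] -/
lemma pairing_def {n o : Type*} [Fintype n] [Fintype o] (δ : R →+ M) (P : Matrix n o R) (Q : Matrix o n R) :
    pairing δ P Q = ∑ m, ∑ i, P m i • δ (Q i m) := rfl

/-- The pairing is additive in `Q`. [folklore] -/
lemma pairing_add_right {n o : Type*} [Fintype n] [Fintype o] (δ : R →+ M) (P : Matrix n o R)
    (Q Q' : Matrix o n R) : pairing δ P (Q + Q') = pairing δ P Q + pairing δ P Q' := by
  simp only [pairing, Matrix.add_apply, map_add, smul_add, Finset.sum_add_distrib]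

/-- The pairing is additive in `P`. [folklore] -/
lemma pairing_add_left {n o : Type*} [Fintype n] [Fintype o] (δ : R →+ M) (P P' : Matrix n o R)
    (Q : Matrix o n R) : pairing δ (P + P') Q = pairing δ P Q + pairing δ P' Q := by
  simp only [pairing, Matrix.add_apply, add_smul, Finset.sum_add_distrib]

/-- **Block upper triangular pairings split into the diagonal pairings** (rectangular blocks).
[cite: BuchweitzFlenner2003, Prop. 4.2] -/
theorem pairing_fromBlocks {n₁ n₂ o₁ o₂ : Type*} [Fintype n₁] [Fintype n₂] [Fintype o₁] [Fintype o₂]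
    (δ : R →+ M) (P₁ : Matrix n₁ o₁ R) (P₂ : Matrix n₁ o₂ R) (P₃ : Matrix n₂ o₂ R)
    (Q₁ : Matrix o₁ n₁ R) (Q₂ : Matrix o₁ n₂ R) (Q₃ : Matrix o₂ n₂ R) :
    pairing δ (fromBlocks P₁ P₂ 0 P₃) (fromBlocks Q₁ Q₂ 0 Q₃) = pairing δ P₁ Q₁ + pairing δ P₃ Q₃ := by
  simp only [pairing, Fintype.sum_sum_type, fromBlocks_apply₁₁, fromBlocks_apply₁₂, fromBlocks_apply₂₁,
    fromBlocks_apply₂₂, Matrix.zero_apply, map_zero, smul_zero, zero_smul, Finset.sum_const_zero,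
    add_zero, zero_add]

/-- The version with products: if `P = [[P₁,*],[0,P₃]]`, `A = [[A₁,*],[0,A₃]]`, `B = [[B₁,*],[0,B₃]]`
(rectangular blocks of compatible sizes) then `⟪P, A·B⟫_δ = ⟪P₁, A₁B₁⟫_δ + ⟪P₃, A₃B₃⟫_δ`.
[cite: BuchweitzFlenner2003, Prop. 4.2] -/
theorem pairing_fromBlocks_mul {n₁ n₂ o₁ o₂ l₁ l₂ : Type*} [Fintype n₁] [Fintype n₂] [Fintype o₁]
    [Fintype o₂] [Fintype l₁] [Fintype l₂] (δ : R →+ M)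
    (P₁ : Matrix n₁ o₁ R) (P₂ : Matrix n₁ o₂ R) (P₃ : Matrix n₂ o₂ R)
    (A₁ : Matrix o₁ l₁ R) (A₂ : Matrix o₁ l₂ R) (A₃ : Matrix o₂ l₂ R)
    (B₁ : Matrix l₁ n₁ R) (B₂ : Matrix l₁ n₂ R) (B₃ : Matrix l₂ n₂ R) :
    pairing δ (fromBlocks P₁ P₂ 0 P₃) (fromBlocks A₁ A₂ 0 A₃ * fromBlocks B₁ B₂ 0 B₃) =
      pairing δ P₁ (A₁ * B₁) + pairing δ P₃ (A₃ * B₃) := by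
  rw [Literature.AlgebraicGeometry.Modules.fromBlocks_zero₂₁_mul_fromBlocks_zero₂₁, pairing_fromBlocks]

end Pairing

/-! ### Components of `toLocalFamily` over smaller opens -/

section Component

open Literature.AlgebraicGeometry.Modules Literature.AlgebraicGeometry.Motives

variable {X : Scheme.{u}} {E : X.Modules} {ι : Type u} (𝔣 : Framing E ι) {n : ℕ}

/-- The value of a component of `toLocalFamily c` (`Modules/CechEndCochainFamily.lean`) over a smaller
open `W ≤ U_γ` is the local operator of the matrix over `W`. [folklore] -/
theorem appLE_toLocalFamily (c : 𝔣.Cochain n) (γ : Fin (n + 1) → ι) {W : X.Opens}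
    (k : W ⟶ face 𝔣.U γ) (s : Γ(E, W)) :
    appLE (𝔣.toLocalFamily c γ) k s =
      appLE (𝔣.op (γ 0) (γ (Fin.last n)) W (k.le.trans (face_le 𝔣.U γ 0))
        (k.le.trans (face_le 𝔣.U γ (Fin.last n))) (c.mat γ W fun m => k.le.trans (face_le 𝔣.U γ m)))
        (𝟙 W) s := by
  rw [← 𝔣.restrictHom_toLocalFamily c γ k, appLE_restrictHom, Category.id_comp]

end Component

/-! ### The contraction of the cup product with the Atiyah cocycle, in a frame -/

section Contract

open Literature.AlgebraicGeometry.Modules Literature.AlgebraicGeometry.Motives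
  Literature.AlgebraicGeometry.HodgeTheory

variable {k : Type u} [CommRing k] {Y : Over (Spec (CommRingCat.of k))} {E : Y.left.Modules}
  (hE : IsFiniteLocallyFree E) {ι : Type u} (𝔣 : Framing E ι)

/-- The universal derivation on sections over `V`, as an additive map. [folklore] -/
def dAddHom (V : Y.left.Opens) : Γ(Y.left, V) →+ Γ(cotangentSheaf Y, V) :=
  ⟨⟨dSection Y V, dSection_zero⟩, dSection_add⟩

/-- Unfolding `dAddHom`. [folklore] -/
@[simp] lemma dAddHom_apply (V : Y.left.Opens) (a : Γ(Y.left, V)) : dAddHom (Y := Y) V a = dSection Y V a := rfl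

/-- The value of the twisting term on a dual basis vector: `⟨δ(c, s), λ_i⟩ = λ_i(s) · dc`. [folklore] -/
lemma appLE_deltaHom_dualBasis {I : Type u} (V : Y.left.Opens) (e : SheafOfModules.free I ≅ E.over V)
    (c : Γ(Y.left, V)) (s : Γ(E, V)) (i : I) :
    appLE (deltaHom E V c s) (𝟙 V) (dualBasis e i : Γ(dual E, V)) = coord e (𝟙 V) s i • dSection Y V c := by
  rw [deltaHom, appLE_comp, appLE_smulSection, appLE_evalAt, presheaf_map_id, presheaf_map_id]
  rfl

omit hE in
/-- `appLE` is compatible with subtraction (general modules). [folklore] -/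
lemma appLE_sub_hom {M N : Y.left.Modules} {W V : Y.left.Opens} (φ ψ : M.over W ⟶ N.over W) (k : V ⟶ W)
    (s : Γ(M, V)) : appLE (φ - ψ) k s = appLE φ k s - appLE ψ k s :=
  map_sub (appLEHom k s) φ ψ

variable {W V : Y.left.Opens} {I : Type u}

/-- Coordinates of a frame combination: `λ_i(Σ_n N_n b_n|) = Σ_n N_n λ_i(b_n|)`. [folklore] -/
lemma coord_sum_smul (e : SheafOfModules.free I ≅ E.over W) {J : Type*} [Fintype J] (l : V ⟶ W)
    (N : J → Γ(Y.left, V)) (t : J → Γ(E, V)) (i : I) :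
    coord e l (∑ n, N n • t n) i = ∑ n, N n * coord e l (t n) i := by
  rw [coord_sum]
  exact Finset.sum_congr rfl fun n _ => coord_smul e l (N n) (t n) i

/-- Restricted basis sections in the notation of the statements below. [folklore] -/
abbrev bOn (e : SheafOfModules.free I ≅ E.over W) (l : V ≤ W) (m : I) : Γ(E, V) :=
  E.presheaf.map (homOfLE l).op (basisSection e m)

/-- **The contraction of `ω ∪ At` in a frame.** For a matrix `2`-cochain `κ` of the framing `𝔣` (e.g. the
defect of lifted transition matrices read on the base), a `3`-simplex `β = (a, b, d, e)` and
`V = U_β`, the `Ω¹`-valued contraction of the `β`-component of the cup product of the Čech cochain of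
`κ` with the Atiyah cocycle of `𝔣` is, with `N = κ_{abd} · T_{da}` (the matrix of the front
component in the frame `e_a`),

  `⟨(ω ∪ At)_β⟩ = Σ_{m,i} (T_{ad})_{mi} d((T_{da} N)_{im}) - Σ_{m,j} (T_{ae})_{mj} d((T_{ea} N)_{jm})`,

a difference of two `d`-pairings. [cite: BuchweitzFlenner2003, Prop. 4.2] -/
theorem contract_cupFamily_atiyahCocycle (κ : 𝔣.Cochain 2) (β : Fin 4 → ι) :
    (contract hE (cotangentSheaf Y)).app (face 𝔣.U β)
        (Cech.cupFamily (atiyahCocycle 𝔣) (𝔣.toLocalFamily κ) β) =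
      pairing (dAddHom (face 𝔣.U β))
          (𝔣.T (Cech.front β 0) (Cech.back 2 β 0) (face 𝔣.U β)
            ((Cech.face_le_face_front 𝔣.U β).trans (face_le 𝔣.U _ 0))
            ((Cech.face_le_face_back 𝔣.U 2 β).trans (face_le 𝔣.U _ 0)))
          (𝔣.T (Cech.back 2 β 0) (Cech.front β 0) (face 𝔣.U β)
            ((Cech.face_le_face_back 𝔣.U 2 β).trans (face_le 𝔣.U _ 0))
            ((Cech.face_le_face_front 𝔣.U β).trans (face_le 𝔣.U _ 0)) *
            (κ.mat (Cech.front β) (face 𝔣.U β) (fun m => (Cech.face_le_face_front 𝔣.U β).trans (face_le 𝔣.U _ m)) *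
              𝔣.T (Cech.front β (Fin.last 2)) (Cech.front β 0) (face 𝔣.U β)
                ((Cech.face_le_face_front 𝔣.U β).trans (face_le 𝔣.U _ (Fin.last 2)))
                ((Cech.face_le_face_front 𝔣.U β).trans (face_le 𝔣.U _ 0)))) -
        pairing (dAddHom (face 𝔣.U β))
          (𝔣.T (Cech.front β 0) (Cech.back 2 β 1) (face 𝔣.U β)
            ((Cech.face_le_face_front 𝔣.U β).trans (face_le 𝔣.U _ 0))
            ((Cech.face_le_face_back 𝔣.U 2 β).trans (face_le 𝔣.U _ 1)))
          (𝔣.T (Cech.back 2 β 1) (Cech.front β 0) (face 𝔣.U β)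
            ((Cech.face_le_face_back 𝔣.U 2 β).trans (face_le 𝔣.U _ 1))
            ((Cech.face_le_face_front 𝔣.U β).trans (face_le 𝔣.U _ 0)) *
            (κ.mat (Cech.front β) (face 𝔣.U β) (fun m => (Cech.face_le_face_front 𝔣.U β).trans (face_le 𝔣.U _ m)) *
              𝔣.T (Cech.front β (Fin.last 2)) (Cech.front β 0) (face 𝔣.U β)
                ((Cech.face_le_face_front 𝔣.U β).trans (face_le 𝔣.U _ (Fin.last 2)))
                ((Cech.face_le_face_front 𝔣.U β).trans (face_le 𝔣.U _ 0)))) := by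
  -- notation
  set V := face 𝔣.U β with hV
  have hf : ∀ m, V ≤ 𝔣.U (Cech.front β m) := fun m => (Cech.face_le_face_front 𝔣.U β).trans (face_le 𝔣.U _ m)
  have hb : ∀ m, V ≤ 𝔣.U (Cech.back 2 β m) := fun m => (Cech.face_le_face_back 𝔣.U 2 β).trans (face_le 𝔣.U _ m)
  set N := κ.mat (Cech.front β) V hf * 𝔣.T (Cech.front β (Fin.last 2)) (Cech.front β 0) V (hf (Fin.last 2)) (hf 0)
    with hN
  -- the frame of `E|_V` at the vertex `a = β 0`
  set eV := SheafOfModules.restrictTrivialisation (R := Y.left.ringCatSheaf) (homOfLE (hf 0))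
    (𝔣.e (Cech.front β 0)) with heV
  rw [contract_app_eq_frameContract hE _ eV]
  unfold frameContract
  -- the value of the cup product on the basis section `b^a_m|_V`
  have hval : ∀ m, appLE (Cech.cupFamily (atiyahCocycle 𝔣) (𝔣.toLocalFamily κ) β) (𝟙 V)
      (basisSection (E := E) eV m) =
      ∑ i, deltaHom E V ((𝔣.T (Cech.back 2 β 0) (Cech.front β 0) V (hb 0) (hf 0) * N) i m)
          (bOn (𝔣.e (Cech.back 2 β 0)) (hb 0) i) -
        ∑ j, deltaHom E V ((𝔣.T (Cech.back 2 β 1) (Cech.front β 0) V (hb 1) (hf 0) * N) j m)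
          (bOn (𝔣.e (Cech.back 2 β 1)) (hb 1) j) := by
    intro m
    rw [heV, basisSection_restrictTrivialisation, Cech.appLE_cupFamily, appLE_toLocalFamily, Framing.op,
      appLE_matrixEnd_basisSection, appLE_atiyahCocycle]
    have e0 : ((𝟙 V ≫ homOfLE (Cech.face_le_face_back 𝔣.U 2 β)) ≫ homOfLE (face_le 𝔣.U (Cech.back 2 β) 0)) =
        homOfLE (hb 0) := Subsingleton.elim _ _
    have e1 : ((𝟙 V ≫ homOfLE (Cech.face_le_face_back 𝔣.U 2 β)) ≫ homOfLE (face_le 𝔣.U (Cech.back 2 β) 1)) =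
        homOfLE (hb 1) := Subsingleton.elim _ _
    rw [e0, e1]
    simp only [coord_sum_smul, ← transition_apply]
    congr 1 <;> refine Finset.sum_congr rfl (fun i _ => ?_) <;> congr 1 <;>
      (rw [Matrix.mul_apply]; refine Finset.sum_congr rfl (fun n _ => ?_); rw [mul_comm]; rfl)
  simp_rw [hval]
  -- apply the dual basis vectors
  rw [pairing_def, pairing_def, ← Finset.sum_sub_distrib]
  refine Finset.sum_congr rfl fun m _ => ?_
  rw [appLE_sub_hom, appLE_sum, appLE_sum]
  simp only [appLE_deltaHom_dualBasis, dAddHom_apply]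
  have hc : ∀ (d : ι) (hd : V ≤ 𝔣.U d) (i : 𝔣.I d),
      coord eV (𝟙 V) (bOn (𝔣.e d) hd i) m = 𝔣.T (Cech.front β 0) d V (hf 0) hd m i := by
    intro d hd i
    rw [heV, coord_restrictTrivialisation, Category.id_comp]
    rfl
  congr 1 <;> refine Finset.sum_congr rfl (fun i _ => ?_) <;> rw [hc]

end Contract

/-! ### Additivity along a short exact sequence with adapted frames and adapted lifts -/

section Adapted

open Literature.AlgebraicGeometry.Modules Literature.AlgebraicGeometry.Motives
  Literature.AlgebraicGeometry.HodgeTheory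

variable {k : Type u} [CommRing k] {Y : Over (Spec (CommRingCat.of k))} {Z₀ Z₁ : Scheme.{u}}
  {j : Y.left ⟶ Z₀} {i : Z₀ ⟶ Z₁}
  (eI : (Scheme.Modules.pushforward i).obj ((Scheme.Modules.pushforward j).obj (unitModule Y.left)) ≅
    idealModule i)
  {S : ShortComplex Z₀.Modules} {hS : S.ShortExact} {ι : Type u} {A : AdaptedFrameCover i S ι}
  (L₁ : A.cover₁.Lifts) (L₃ : A.cover₃.Lifts)
  (X : ∀ a b, Matrix (A.I₁ a) (A.I₃ b) Γ(Z₁, A.U a ⊓ A.U b))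
  (hX : ∀ a b, (X a b).map (i.app (A.U a ⊓ A.U b)).hom =
    A.offDiag (hS := hS) a b (A.U a ⊓ A.U b) inf_le_left inf_le_right)
  (h₁ : IsFiniteLocallyFree ((Scheme.Modules.pullback j).obj S.X₁))
  (h₂ : IsFiniteLocallyFree ((Scheme.Modules.pullback j).obj S.X₂))
  (h₃ : IsFiniteLocallyFree ((Scheme.Modules.pullback j).obj S.X₃))

/-- **Additivity of the `Ω¹`-contraction of `ω ∪ At` for adapted data.** For a short exact sequence
`0 → F₁ → F₂ → F₃ → 0` of `𝒪_{Z₀}`-modules with an adapted frame cover and adapted lifts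
(`Deformation/AdaptedLifts.lean`), the contractions of the `β`-components of the cup products of the
three families of local endomorphisms `ω_m = op(κ(c^m))` with the three Atiyah cocycles (all on the
cover `(j⁻¹i⁻¹U_a)_a` of `Y`, in the base framings) satisfy `c₂ = c₁ + c₃`: every matrix in the frame
formula `contract_cupFamily_atiyahCocycle` is block upper triangular (`T_baseFraming_cover₂`,
`kdefAt_adapted`) and `pairing_fromBlocks_mul` applies. This is the cochain-level content of the
additivity of `σ₁ = tr(At · ob)` in Buchweitz–Flenner, Prop. 4.2. [cite: BuchweitzFlenner2003, Prop. 4.2] -/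
theorem contract_cupFamily_atiyahCocycle_adapted (β : Fin 4 → ι) :
    (contract h₂ (cotangentSheaf Y)).app (face ((A.cover₂ hS).baseFraming j).U β)
        (Cech.cupFamily (atiyahCocycle ((A.cover₂ hS).baseFraming j))
          (((A.cover₂ hS).baseFraming j).toLocalFamily
            ((AdaptedFrameCover.Lifts.adapted (hS := hS) L₁ L₃ X hX).defectCochain eI)) β) =
      (contract h₁ (cotangentSheaf Y)).app (face (A.cover₁.baseFraming j).U β)
          (Cech.cupFamily (atiyahCocycle (A.cover₁.baseFraming j))
            ((A.cover₁.baseFraming j).toLocalFamily (L₁.defectCochain eI)) β) +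
        (contract h₃ (cotangentSheaf Y)).app (face (A.cover₃.baseFraming j).U β)
          (Cech.cupFamily (atiyahCocycle (A.cover₃.baseFraming j))
            ((A.cover₃.baseFraming j).toLocalFamily (L₃.defectCochain eI)) β) := by
  rw [contract_cupFamily_atiyahCocycle, contract_cupFamily_atiyahCocycle,
    contract_cupFamily_atiyahCocycle]
  simp only [FrameCover.Lifts.defectCochain_mat]
  have hf : ∀ m, face ((A.cover₂ hS).baseFraming j).U β ≤ baseOpen j i (A.U (Cech.front β m)) := fun m =>
    (Cech.face_le_face_front ((A.cover₂ hS).baseFraming j).U β).trans (face_le _ _ m)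
  have hb : ∀ m, face ((A.cover₂ hS).baseFraming j).U β ≤ baseOpen j i (A.U (Cech.back 2 β m)) := fun m =>
    (Cech.face_le_face_back ((A.cover₂ hS).baseFraming j).U 2 β).trans (face_le _ _ m)
  obtain ⟨M, hM⟩ := kdefAt_adapted eI (hS := hS) L₁ L₃ X hX (Cech.front β 0) (Cech.front β 1)
    (Cech.front β (Fin.last 2))
    (A.U (Cech.front β 0) ⊓ A.U (Cech.front β 1) ⊓ A.U (Cech.front β (Fin.last 2)))
    (inf_le_left.trans inf_le_left) (inf_le_left.trans inf_le_right) inf_le_right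
  obtain ⟨M₁, hM₁⟩ := T_baseFraming_cover₂ (hS := hS) L₁ L₃ X hX (Cech.front β 0) (Cech.back 2 β 0)
    (face ((A.cover₂ hS).baseFraming j).U β) (hf 0) (hb 0)
  obtain ⟨M₂, hM₂⟩ := T_baseFraming_cover₂ (hS := hS) L₁ L₃ X hX (Cech.back 2 β 0) (Cech.front β 0)
    (face ((A.cover₂ hS).baseFraming j).U β) (hb 0) (hf 0)
  obtain ⟨M₃, hM₃⟩ := T_baseFraming_cover₂ (hS := hS) L₁ L₃ X hX (Cech.front β (Fin.last 2)) (Cech.front β 0)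
    (face ((A.cover₂ hS).baseFraming j).U β) (hf (Fin.last 2)) (hf 0)
  obtain ⟨M₄, hM₄⟩ := T_baseFraming_cover₂ (hS := hS) L₁ L₃ X hX (Cech.front β 0) (Cech.back 2 β 1)
    (face ((A.cover₂ hS).baseFraming j).U β) (hf 0) (hb 1)
  obtain ⟨M₅, hM₅⟩ := T_baseFraming_cover₂ (hS := hS) L₁ L₃ X hX (Cech.back 2 β 1) (Cech.front β 0)
    (face ((A.cover₂ hS).baseFraming j).U β) (hb 1) (hf 0)
  rw [hM, hM₁, hM₂, hM₃, hM₄, hM₅, fromBlocks_zero₂₁_map _ _ _ _ (map_zero _),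
    fromBlocks_zero₂₁_mul_fromBlocks_zero₂₁]
  rw [pairing_fromBlocks_mul, pairing_fromBlocks_mul]
  exact add_sub_add_comm _ _ _ _

/-- `smulSection` is additive. [folklore] -/
lemma smulSection_add {X : Scheme.{u}} {N : X.Modules} {W : X.Opens} (b b' : Γ(N, W)) :
    smulSection (b + b') = smulSection b + smulSection b' :=
  hom_ext_of_appLE fun _ k r => by rw [appLE_add, appLE_smulSection, appLE_smulSection, appLE_smulSection, map_add, smul_add]

/-- **Additivity of the pushed-forward cochains `c_{Ω¹,*}(ω_m ∪ At_m)`** (`Cech.pushFamily`,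
`Modules/CechSheafHomExchange.lean`) for adapted data: `push₂ = push₁ + push₃` as cochains of local
homomorphisms `𝒪 → Ω¹` on the common cover of `Y`. [cite: BuchweitzFlenner2003, Prop. 4.2] -/
theorem pushFamily_contract_cupFamily_adapted :
    Cech.pushFamily (contract h₂ (cotangentSheaf Y))
        (Cech.cupFamily (atiyahCocycle ((A.cover₂ hS).baseFraming j))
          (((A.cover₂ hS).baseFraming j).toLocalFamily
            ((AdaptedFrameCover.Lifts.adapted (hS := hS) L₁ L₃ X hX).defectCochain eI))) =
      Cech.pushFamily (contract h₁ (cotangentSheaf Y))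
          (Cech.cupFamily (atiyahCocycle (A.cover₁.baseFraming j))
            ((A.cover₁.baseFraming j).toLocalFamily (L₁.defectCochain eI))) +
        Cech.pushFamily (contract h₃ (cotangentSheaf Y))
          (Cech.cupFamily (atiyahCocycle (A.cover₃.baseFraming j))
            ((A.cover₃.baseFraming j).toLocalFamily (L₃.defectCochain eI))) := by
  funext β
  rw [Pi.add_apply, Cech.pushFamily_apply, Cech.pushFamily_apply, Cech.pushFamily_apply, ← smulSection_add,
    contract_cupFamily_atiyahCocycle_adapted]

end Adapted




end Literature.AlgebraicGeometry.Deformation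

end
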